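import Summits.AtomisticToContinuum.FouriersLaw.Theses.EmbeddedDrudeMourre
import Summits.AtomisticToContinuum.FouriersLaw.Theorems.DrudeDissolution.Negative.WeakAnharmonicityForm
import Summits.AtomisticToContinuum.FouriersLaw.Theorems.EmbeddedDrudeMourreMourreDissolutionSpectralWindow
import Summits.AtomisticToContinuum.FouriersLaw.Theorems.EmbeddedDrudeMourreFGRGap
import Literature.MathematicalPhysics.KineticTheory.ZeroWavenumberSpace
import Literature.MathematicalPhysics.KineticTheory.InfiniteChainInvariantStates
import Literature.MathematicalPhysics.KineticTheory.InfiniteChainSuperstableDynamics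
import Literature.MathematicalPhysics.KineticTheory.InfiniteChainGibbsStationarityPinned

/-!
# Stub S `stub_polynomialStationarity` of line `gram-pencil-harmonic-chaos`, crux
`EmbeddedDrudeMourre.DrudeDissolution` (stmt-AtomisticToContinuum-12593; `--supports` file, closes nothing)

**Generator-sense stationarity of the thermal states on local polynomials.** For the pinned chain
`P = pinnedChain ω₂ lam β γ` (`U = ω₂q²/2 + lam q⁴/4`, `V = r²/2 + βr⁴/4`; `ω₂ > 0`, `lam, β ≥ 0` — the
harmonic endpoint included — any `γ`), every temperature `T > 0`, every shift-invariant DLR Gibbs state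
`μ` of `P` at `T` and every local polynomial observable
`f ∈ 𝒫 := Algebra.adjoin ℝ {σ ↦ q_x, σ ↦ p_x}`: the Liouville derivative `𝒜f = liouvilleZ P f` is
`μ`-integrable and `∫ 𝒜f dμ = 0`.

Proof. The tree's `OscillatorChain.IsChainGibbsMeasure.integral_liouvilleZ_comp_boxRestrictAt_eq_zero`
(LLL 1977 §4 (i): FTC along the severed flow `T^Λ_s`, Fubini, `T^Λ_s`-invariance of `μ`) uses the
boundedness of the profile only to make `f` and `f ∘ T^Λ_1` integrable; here
(`integral_liouvilleZ_comp_boxRestrictAt_eq_zero_of_integrable`) that is replaced by the hypothesis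
`f ∈ L¹(μ)` plus measure preservation. For `f ∈ 𝒫` everything needed is bookkeeping:

* `measurable_and_integrable_pow_of_mem_polyObs` — every element of `𝒫` is measurable with ALL
  moments finite under a shift-invariant DLR state (generators: the uniform site moments
  `exists_integral_abs_pow_add_le_pinnedChain_of_isShiftInvariant`; closure under `+`, `*` by
  `(a+b)^k ≤ 2^{k-1}(a^k+b^k)` and `ab ≤ a²+b²`);
* `exists_rep_and_liouvilleZ_mem_of_mem_polyObs` — every `f ∈ 𝒫` is `g ∘ boxRestrict R` with a `C¹`
  (polynomial) profile on every large centred box, and `𝒜f ∈ 𝒫` (Hamilton's equations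
  `𝒜q_x = p_x`, `𝒜p_x = F_x` with `F_x` a cubic polynomial — `force_pinnedChain_mem` —, additivity
  and the Leibniz rule of `𝒜`
  on local `C¹` functions — the tree's `IsLocalTestFunction.liouvilleZ_add/_mul` minus boundedness).

No named fact is used; everything is in the tree (`InfiniteChainGibbsStationarity(Pinned)`,
`InfiniteChainObservables`, `InfiniteChainSeveredGibbs`).
-/

noncomputable section

namespace Summit.AtomisticToContinuum.FouriersLaw.Theorems.DrudeDissolution.GramPencilHarmonicChaos

open MeasureTheory Filter Set Function Topology
open scoped InnerProductSpace ENNReal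
open Literature.MathematicalPhysics.KineticTheory
open Literature.MathematicalPhysics.KineticTheory.HeatConduction
open Literature.MathematicalPhysics.KineticTheory.PhononBoltzmann

/-! ## Stationarity in the box form, for integrable (possibly unbounded) profiles -/

/-- **Gibbs states are stationary in the generator sense, box form, unbounded profiles.** Let
`U, V ∈ C²`, let the severed dynamics exist globally (B1), and let `μ` be a DLR Gibbs state of the
chain at temperature `T`. Then `∫ 𝒜(g ∘ box_{a,n}) dμ = 0` for every `C¹` profile `g` on the box
`{a, …, a+n}` with `g ∘ box_{a,n} ∈ L¹(μ)` and `𝒜(g ∘ box_{a,n})` measurable and `μ`-integrable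
(the tree's `IsChainGibbsMeasure.integral_liouvilleZ_comp_boxRestrictAt_eq_zero` with boundedness of
`g` replaced by integrability: `f ∘ T^Λ_1 ∈ L¹` by invariance of `μ` under the severed flow).
[cite: LanfordLebowitzLieb1977, §4 remark (i)] -/
theorem integral_liouvilleZ_comp_boxRestrictAt_eq_zero_of_integrable {P : OscillatorChain}
    (hU : ContDiff ℝ 2 P.U) (hV : ContDiff ℝ 2 P.V) (hB1 : P.CondB1) {T : ℝ} {μ : Measure ChainConfig}
    (hμ : P.IsChainGibbsMeasure T μ) (a : ℤ) (n : ℕ) {g : (Fin (n + 1) → ℝ × ℝ) → ℝ}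
    (hg : ContDiff ℝ 1 g) (hfi : Integrable (g ∘ boxRestrictAt a n) μ)
    (hFm : Measurable (liouvilleZ P (g ∘ boxRestrictAt a n)))
    (hint : Integrable (liouvilleZ P (g ∘ boxRestrictAt a n)) μ) :
    ∫ σ, liouvilleZ P (g ∘ boxRestrictAt a n) σ ∂μ = 0 := by
  haveI : IsProbabilityMeasure μ := hμ.isProbabilityMeasure
  have hfm : Measurable (g ∘ boxRestrictAt a n) :=
    hg.continuous.measurable.comp (boxRestrictAt_measurable a n)
  set Λ : Finset ℤ := Finset.Icc a (a + n) with hΛ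
  -- (A) invariance at every time, for `𝒜f` and for `f`
  have hA : ∀ s : ℝ,
      ∫ σ, liouvilleZ P (g ∘ boxRestrictAt a n) (OscillatorChain.severedFlow hB1 Λ s σ) ∂μ =
      ∫ σ, liouvilleZ P (g ∘ boxRestrictAt a n) σ ∂μ := fun s =>
    OscillatorChain.integral_comp_severedFlow_of_isChainGibbsMeasure hU hV hB1 Λ hμ s hFm
  have hA' : ∫ σ, (g ∘ boxRestrictAt a n) (OscillatorChain.severedFlow hB1 Λ 1 σ) ∂μ =
      ∫ σ, (g ∘ boxRestrictAt a n) σ ∂μ :=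
    OscillatorChain.integral_comp_severedFlow_of_isChainGibbsMeasure hU hV hB1 Λ hμ 1 hfm
  -- (B) FTC along the severed orbits
  have hB : ∀ σ : ChainConfig, ∫ s in (0 : ℝ)..1,
      liouvilleZ P (g ∘ boxRestrictAt a n) (OscillatorChain.severedFlow hB1 Λ s σ) =
      (g ∘ boxRestrictAt a n) (OscillatorChain.severedFlow hB1 Λ 1 σ) - (g ∘ boxRestrictAt a n) σ :=
    fun σ => OscillatorChain.integral_liouvilleZ_severedFlow_eq_sub hU hV hB1 a n hg σ 1
  -- (C) integrability on `[0, 1] × Ω`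
  have hmeasU : Measurable fun p : ℝ × ChainConfig =>
      liouvilleZ P (g ∘ boxRestrictAt a n) (OscillatorChain.severedFlow hB1 Λ p.1 p.2) :=
    hFm.comp (OscillatorChain.measurable_severedFlow_uncurry hB1 Λ hU hV)
  have hC' : Integrable (fun p : ℝ × ChainConfig =>
      liouvilleZ P (g ∘ boxRestrictAt a n) (OscillatorChain.severedFlow hB1 Λ p.1 p.2))
      ((volume.restrict (Ioc (0 : ℝ) 1)).prod μ) := by
    refine ⟨hmeasU.aestronglyMeasurable, ?_⟩
    unfold HasFiniteIntegral
    rw [lintegral_prod _ hmeasU.enorm.aemeasurable]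
    have hinner : ∀ s : ℝ,
        ∫⁻ σ, ‖liouvilleZ P (g ∘ boxRestrictAt a n) (OscillatorChain.severedFlow hB1 Λ s σ)‖ₑ ∂μ =
        ∫⁻ σ, ‖liouvilleZ P (g ∘ boxRestrictAt a n) σ‖ₑ ∂μ := fun s =>
      OscillatorChain.lintegral_comp_severedFlow_of_isChainGibbsMeasure hU hV hB1 Λ hμ s hFm.enorm
    simp only [hinner, lintegral_const, Measure.restrict_apply_univ, Real.volume_Ioc, sub_zero,
      ENNReal.ofReal_one, mul_one]
    exact hint.2
  have hC : Integrable (Function.uncurry fun (s : ℝ) (σ : ChainConfig) =>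
      liouvilleZ P (g ∘ boxRestrictAt a n) (OscillatorChain.severedFlow hB1 Λ s σ))
      ((volume.restrict (Ioc (0 : ℝ) 1)).prod μ) := hC'
  -- (D) Fubini, and evaluation of both iterated integrals
  have hD := integral_integral_swap hC
  have hL : ∫ s in Ioc (0 : ℝ) 1,
      ∫ σ, liouvilleZ P (g ∘ boxRestrictAt a n) (OscillatorChain.severedFlow hB1 Λ s σ) ∂μ =
      ∫ σ, liouvilleZ P (g ∘ boxRestrictAt a n) σ ∂μ := by
    simp only [hA, setIntegral_const, Real.volume_real_Ioc, sub_zero, max_eq_left zero_le_one,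
      one_smul]
  have hR : ∫ σ, (∫ s in Ioc (0 : ℝ) 1,
      liouvilleZ P (g ∘ boxRestrictAt a n) (OscillatorChain.severedFlow hB1 Λ s σ)) ∂μ = 0 := by
    have hpt : ∀ σ, ∫ s in Ioc (0 : ℝ) 1,
        liouvilleZ P (g ∘ boxRestrictAt a n) (OscillatorChain.severedFlow hB1 Λ s σ) =
        (g ∘ boxRestrictAt a n) (OscillatorChain.severedFlow hB1 Λ 1 σ) - (g ∘ boxRestrictAt a n) σ :=
      fun σ => by rw [← intervalIntegral.integral_of_le zero_le_one, hB σ]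
    simp only [hpt]
    have h1 :
        Integrable (fun σ => (g ∘ boxRestrictAt a n) (OscillatorChain.severedFlow hB1 Λ 1 σ)) μ :=
      ((OscillatorChain.measurePreserving_severedFlow_of_isChainGibbsMeasure hU hV hB1 Λ hμ
        1).integrable_comp hfi.aestronglyMeasurable).mpr hfi
    rw [integral_sub h1 hfi, hA', sub_self]
  rw [← hL, hD, hR]

/-! ## The Liouville operator on local `C¹` functions: additivity and the Leibniz rule -/

/-- **`𝒜` is additive on local `C¹` functions represented on a common centred box** (box formula;
no boundedness needed). [folklore] -/
theorem liouvilleZ_add_comp_boxRestrict (P : OscillatorChain) (R : ℕ)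
    {g₁ g₂ : (Fin (2 * R + 1) → ℝ × ℝ) → ℝ} (h₁ : Differentiable ℝ g₁) (h₂ : Differentiable ℝ g₂) :
    liouvilleZ P (g₁ ∘ boxRestrict R + g₂ ∘ boxRestrict R) =
      liouvilleZ P (g₁ ∘ boxRestrict R) + liouvilleZ P (g₂ ∘ boxRestrict R) := by
  have hsum : g₁ ∘ boxRestrict R + g₂ ∘ boxRestrict R = (g₁ + g₂) ∘ boxRestrict R := rfl
  rw [hsum]
  funext σ
  have hd₁ : DifferentiableAt ℝ g₁ (boxRestrict R σ) := h₁ _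
  have hd₂ : DifferentiableAt ℝ g₂ (boxRestrict R σ) := h₂ _
  rw [Pi.add_apply, liouvilleZ_comp_boxRestrict P _ σ (hd₁.add hd₂),
    liouvilleZ_comp_boxRestrict P _ σ hd₁, liouvilleZ_comp_boxRestrict P _ σ hd₂,
    ← Finset.sum_add_distrib]
  refine Finset.sum_congr rfl fun i _ => ?_
  rw [fderiv_add hd₁ hd₂, add_apply, add_apply]
  ring

/-- **Leibniz rule for `𝒜` on local `C¹` functions represented on a common centred box**:
`𝒜(f₁f₂) = f₁ 𝒜f₂ + f₂ 𝒜f₁` (box formula and the product rule for `fderiv`; no boundedness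
needed). [folklore] -/
theorem liouvilleZ_mul_comp_boxRestrict (P : OscillatorChain) (R : ℕ)
    {g₁ g₂ : (Fin (2 * R + 1) → ℝ × ℝ) → ℝ} (h₁ : Differentiable ℝ g₁) (h₂ : Differentiable ℝ g₂) :
    liouvilleZ P (g₁ ∘ boxRestrict R * g₂ ∘ boxRestrict R) =
      g₁ ∘ boxRestrict R * liouvilleZ P (g₂ ∘ boxRestrict R) +
        g₂ ∘ boxRestrict R * liouvilleZ P (g₁ ∘ boxRestrict R) := by
  have hprod : g₁ ∘ boxRestrict R * g₂ ∘ boxRestrict R = (g₁ * g₂) ∘ boxRestrict R := rfl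
  rw [hprod]
  funext σ
  have hd₁ : DifferentiableAt ℝ g₁ (boxRestrict R σ) := h₁ _
  have hd₂ : DifferentiableAt ℝ g₂ (boxRestrict R σ) := h₂ _
  rw [Pi.add_apply, Pi.mul_apply, Pi.mul_apply, liouvilleZ_comp_boxRestrict P _ σ (hd₁.mul hd₂),
    liouvilleZ_comp_boxRestrict P _ σ hd₁, liouvilleZ_comp_boxRestrict P _ σ hd₂]
  simp only [Function.comp_apply, Finset.mul_sum, ← Finset.sum_add_distrib]
  refine Finset.sum_congr rfl fun i _ => ?_
  rw [fderiv_mul hd₁ hd₂]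
  simp only [add_apply, smul_apply, smul_eq_mul]
  ring

/-- The site `x` with `|x| ≤ R` has an index in the centred box `{-R, …, R}`. [folklore] -/
theorem exists_fin_boxIndex {x : ℤ} {R : ℕ} (hx : x.natAbs ≤ R) :
    ∃ i : Fin (2 * R + 1), ((i : ℕ) : ℤ) - R = x := by
  refine ⟨⟨(x + R).toNat, by omega⟩, ?_⟩
  simp only
  omega

/-! ## Local polynomials: forces, locality, `𝒜`-stability, moments -/

/-- **The forces of the pinned chain are polynomials in the positions**: `F_x = -(ω₂ q_x + lam q_x³) +
(r_x + β r_x³) - (r_{x-1} + β r_{x-1}³)`, `r_x = q_{x+1} - q_x`, lies in every subalgebra of observables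
containing the position coordinates `σ ↦ q_z`. [folklore] -/
theorem force_pinnedChain_mem (ω₂ lam β γ : ℝ) (x : ℤ) (A : Subalgebra ℝ (ChainConfig → ℝ))
    (hq : ∀ z : ℤ, (fun σ : ChainConfig => (σ z).1) ∈ A) :
    (fun σ : ChainConfig => (pinnedChain ω₂ lam β γ).force σ x) ∈ A := by
  set Q : ℤ → ChainConfig → ℝ := fun z σ => (σ z).1 with hQ
  have hF : (fun σ : ChainConfig => (pinnedChain ω₂ lam β γ).force σ x) =
      -(ω₂ • Q x + lam • Q x ^ 3) + ((Q (x + 1) - Q x) + β • (Q (x + 1) - Q x) ^ 3)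
        - ((Q x - Q (x - 1)) + β • (Q x - Q (x - 1)) ^ 3) := by
    funext σ
    simp only [hQ, Pi.add_apply, Pi.sub_apply, Pi.neg_apply, Pi.smul_apply, Pi.pow_apply, smul_eq_mul,
      OscillatorChain.force_eq, pinnedChain_deriv_U_eq, pinnedChain_deriv_V_eq]
  rw [hF]
  refine sub_mem (add_mem (neg_mem (add_mem (A.smul_mem (hq x) _) (A.smul_mem (pow_mem (hq x) 3) _)))
    (add_mem (sub_mem (hq _) (hq _)) (A.smul_mem (pow_mem (sub_mem (hq _) (hq _)) 3) _)))
    (add_mem (sub_mem (hq _) (hq _)) (A.smul_mem (pow_mem (sub_mem (hq _) (hq _)) 3) _))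

/-- **Locality and `𝒜`-stability of local polynomials.** Every `f` in the algebra `𝒫` of local
polynomial observables (the subalgebra of `ChainConfig → ℝ` generated by the coordinates `σ ↦ q_x`,
`σ ↦ p_x`, spelled as in the registered stub) is represented as `g ∘ boxRestrict R` with a `C¹` profile
`g` on every sufficiently large centred box, and its Liouville derivative
`𝒜f = liouvilleZ (pinnedChain ω₂ lam β γ) f` is again in `𝒫` (structural induction on
`Algebra.adjoin`: `𝒜q_x = p_x`, `𝒜p_x = F_x ∈ 𝒫`, `𝒜c = 0`, additivity, Leibniz). [folklore] -/
theorem exists_rep_and_liouvilleZ_mem_of_mem_polyObs (ω₂ lam β γ : ℝ) {f : ChainConfig → ℝ}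
    (hf : f ∈ Algebra.adjoin ℝ (Set.range fun xc : ℤ × Bool => fun σ : ChainConfig =>
      if xc.2 then (σ xc.1).2 else (σ xc.1).1)) :
    (∃ R₀ : ℕ, ∀ R : ℕ, R₀ ≤ R → ∃ g : (Fin (2 * R + 1) → ℝ × ℝ) → ℝ,
        ContDiff ℝ 1 g ∧ f = g ∘ boxRestrict R) ∧
      liouvilleZ (pinnedChain ω₂ lam β γ) f ∈ Algebra.adjoin ℝ (Set.range fun xc : ℤ × Bool =>
        fun σ : ChainConfig => if xc.2 then (σ xc.1).2 else (σ xc.1).1) := by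
  induction hf using Algebra.adjoin_induction with
  | mem f hf =>
    obtain ⟨⟨x, b⟩, rfl⟩ := hf
    cases b
    · simp only [Bool.false_eq_true, if_false]
      refine ⟨⟨x.natAbs, fun R hR => ?_⟩, ?_⟩
      · obtain ⟨i, hi⟩ := exists_fin_boxIndex hR
        refine ⟨fun y => (y i).1, contDiff_fst.comp (contDiff_apply ℝ (ℝ × ℝ) i), ?_⟩
        funext σ
        simp [hi]
      · have h : liouvilleZ (pinnedChain ω₂ lam β γ) (fun σ : ChainConfig => (σ x).1) =
            fun σ => (σ x).2 := funext fun σ => liouvilleZ_position _ x σ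
        rw [h]
        exact Algebra.subset_adjoin ⟨(x, true), by funext σ; simp⟩
    · simp only [if_true]
      refine ⟨⟨x.natAbs, fun R hR => ?_⟩, ?_⟩
      · obtain ⟨i, hi⟩ := exists_fin_boxIndex hR
        refine ⟨fun y => (y i).2, contDiff_snd.comp (contDiff_apply ℝ (ℝ × ℝ) i), ?_⟩
        funext σ
        simp [hi]
      · have h : liouvilleZ (pinnedChain ω₂ lam β γ) (fun σ : ChainConfig => (σ x).2) =
            fun σ => (pinnedChain ω₂ lam β γ).force σ x := funext fun σ => liouvilleZ_momentum _ x σ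
        rw [h]
        exact force_pinnedChain_mem ω₂ lam β γ x _ fun z =>
          Algebra.subset_adjoin ⟨(z, false), by funext σ; simp⟩
  | algebraMap r =>
    have hr : (algebraMap ℝ (ChainConfig → ℝ) r) = fun _ => r := rfl
    rw [hr]
    refine ⟨⟨0, fun R _ => ⟨fun _ => r, contDiff_const, rfl⟩⟩, ?_⟩
    rw [liouvilleZ_const]
    exact zero_mem _
  | add f₁ f₂ hf₁ hf₂ ih₁ ih₂ =>
    obtain ⟨⟨R₁, h₁⟩, hA₁⟩ := ih₁
    obtain ⟨⟨R₂, h₂⟩, hA₂⟩ := ih₂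
    refine ⟨⟨max R₁ R₂, fun R hR => ?_⟩, ?_⟩
    · obtain ⟨g₁, hg₁, rfl⟩ := h₁ R (le_of_max_le_left hR)
      obtain ⟨g₂, hg₂, rfl⟩ := h₂ R (le_of_max_le_right hR)
      exact ⟨g₁ + g₂, hg₁.add hg₂, rfl⟩
    · obtain ⟨g₁, hg₁, rfl⟩ := h₁ (max R₁ R₂) (le_max_left _ _)
      obtain ⟨g₂, hg₂, rfl⟩ := h₂ (max R₁ R₂) (le_max_right _ _)
      rw [liouvilleZ_add_comp_boxRestrict _ _ (hg₁.differentiable one_ne_zero)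
        (hg₂.differentiable one_ne_zero)]
      exact add_mem hA₁ hA₂
  | mul f₁ f₂ hf₁ hf₂ ih₁ ih₂ =>
    obtain ⟨⟨R₁, h₁⟩, hA₁⟩ := ih₁
    obtain ⟨⟨R₂, h₂⟩, hA₂⟩ := ih₂
    refine ⟨⟨max R₁ R₂, fun R hR => ?_⟩, ?_⟩
    · obtain ⟨g₁, hg₁, rfl⟩ := h₁ R (le_of_max_le_left hR)
      obtain ⟨g₂, hg₂, rfl⟩ := h₂ R (le_of_max_le_right hR)
      exact ⟨g₁ * g₂, hg₁.mul hg₂, rfl⟩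
    · obtain ⟨g₁, hg₁, rfl⟩ := h₁ (max R₁ R₂) (le_max_left _ _)
      obtain ⟨g₂, hg₂, rfl⟩ := h₂ (max R₁ R₂) (le_max_right _ _)
      rw [liouvilleZ_mul_comp_boxRestrict _ _ (hg₁.differentiable one_ne_zero)
        (hg₂.differentiable one_ne_zero)]
      exact add_mem (mul_mem hf₁ hA₂) (mul_mem hf₂ hA₁)

/-- **All moments of local polynomials are finite under a shift-invariant thermal state.** For
`ω₂ > 0`, `lam, β ≥ 0`, `T > 0` and a shift-invariant DLR Gibbs state `μ` of `pinnedChain ω₂ lam β γ`,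
every local polynomial observable `f ∈ 𝒫` is measurable with `|f|^k ∈ L¹(μ)` for all `k` (generators:
the uniform site moments of the superstable shift-invariant state; closure:
`|a+b|^k ≤ 2^{k-1}(|a|^k+|b|^k)`, `|ab|^k ≤ |a|^{2k}+|b|^{2k}`). [folklore] -/
theorem measurable_and_integrable_pow_of_mem_polyObs {ω₂ lam β : ℝ} (γ : ℝ) (hω : 0 < ω₂)
    (hl : 0 ≤ lam) (hβ : 0 ≤ β) {T : ℝ} (hT : 0 < T) {μ : Measure ChainConfig}
    (hμ : (pinnedChain ω₂ lam β γ).IsChainGibbsMeasure T μ) (hS : IsShiftInvariant μ)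
    {f : ChainConfig → ℝ} (hf : f ∈ Algebra.adjoin ℝ (Set.range fun xc : ℤ × Bool =>
      fun σ : ChainConfig => if xc.2 then (σ xc.1).2 else (σ xc.1).1)) :
    Measurable f ∧ ∀ k : ℕ, Integrable (fun σ => |f σ| ^ k) μ := by
  haveI : IsProbabilityMeasure μ := hμ.isProbabilityMeasure
  have hmom : ∀ (m : ℕ) (x : ℤ), Integrable (fun σ : ChainConfig => |(σ x).1| ^ m) μ ∧
      Integrable (fun σ : ChainConfig => |(σ x).2| ^ m) μ := fun m x => by
    obtain ⟨C, hC⟩ :=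
      OscillatorChain.exists_integral_abs_pow_add_le_pinnedChain_of_isShiftInvariant γ hω hl hβ hT hμ hS m
    exact OscillatorChain.integrable_abs_pow_of_add (hC x).1
  induction hf using Algebra.adjoin_induction with
  | mem f hf =>
    obtain ⟨⟨x, b⟩, rfl⟩ := hf
    cases b
    · simp only [Bool.false_eq_true, if_false]
      exact ⟨(measurable_pi_apply x).fst, fun k => (hmom k x).1⟩
    · simp only [if_true]
      exact ⟨(measurable_pi_apply x).snd, fun k => (hmom k x).2⟩
  | algebraMap r =>
    have hr : (algebraMap ℝ (ChainConfig → ℝ) r) = fun _ => r := rfl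
    rw [hr]
    exact ⟨measurable_const, fun k => integrable_const _⟩
  | add f₁ f₂ _ _ ih₁ ih₂ =>
    refine ⟨ih₁.1.add ih₂.1, fun k => ?_⟩
    have hdom : Integrable (fun σ => 2 ^ (k - 1) * (|f₁ σ| ^ k + |f₂ σ| ^ k)) μ :=
      ((ih₁.2 k).add (ih₂.2 k)).const_mul _
    refine hdom.mono' ((ih₁.1.add ih₂.1).abs.pow_const k).aestronglyMeasurable
      (Eventually.of_forall fun σ => ?_)
    rw [Real.norm_of_nonneg (by positivity), Pi.add_apply]
    exact (pow_le_pow_left₀ (abs_nonneg _) (abs_add_le _ _) k).trans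
      (add_pow_le (abs_nonneg _) (abs_nonneg _) k)
  | mul f₁ f₂ _ _ ih₁ ih₂ =>
    refine ⟨ih₁.1.mul ih₂.1, fun k => ?_⟩
    have hdom : Integrable (fun σ => |f₁ σ| ^ (2 * k) + |f₂ σ| ^ (2 * k)) μ :=
      (ih₁.2 _).add (ih₂.2 _)
    refine hdom.mono' ((ih₁.1.mul ih₂.1).abs.pow_const k).aestronglyMeasurable
      (Eventually.of_forall fun σ => ?_)
    rw [Real.norm_of_nonneg (by positivity), Pi.mul_apply, abs_mul, mul_pow, pow_mul' |f₁ σ| 2 k,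
      pow_mul' |f₂ σ| 2 k]
    nlinarith [two_mul_le_add_sq (|f₁ σ| ^ k) (|f₂ σ| ^ k),
      mul_nonneg (pow_nonneg (abs_nonneg (f₁ σ)) k) (pow_nonneg (abs_nonneg (f₂ σ)) k)]

/-! ## The stub -/

/-- **STUB S** (M) of line `gram-pencil-harmonic-chaos`: **generator-sense stationarity of the
shift-invariant DLR states of the pinned chain on local polynomials.** For `ω₂ > 0`, `lam, β ≥ 0`
(harmonic endpoint included), any `γ`, every `T > 0`, every shift-invariant DLR Gibbs state `μ` of
`pinnedChain ω₂ lam β γ` at `T` and every `f ∈ Algebra.adjoin ℝ {σ ↦ q_x, σ ↦ p_x}`: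
`liouvilleZ P f ∈ L¹(μ)` and `∫ liouvilleZ P f dμ = 0` — the tree's
`isTimeInvariant_pinnedChain_of_isShiftInvariant` (bounded local `C¹` test functions) extended to
the unbounded polynomial class through the finiteness of all site moments and the severed-flow
invariance of `μ`. [cite: LanfordLebowitzLieb1977, §4 remark (i)] -/
theorem stub_polynomialStationarity :
    ∀ ω₂ lam β γ T : ℝ, 0 < ω₂ → 0 ≤ lam → 0 ≤ β → 0 < T →
      ∀ μ : MeasureTheory.Measure ChainConfig,
        (pinnedChain ω₂ lam β γ).IsChainGibbsMeasure T μ → IsShiftInvariant μ →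
        ∀ f ∈ Algebra.adjoin ℝ (Set.range fun xc : ℤ × Bool => fun σ : ChainConfig => if xc.2 then (σ xc.1).2 else (σ xc.1).1),
          MeasureTheory.Integrable (liouvilleZ (pinnedChain ω₂ lam β γ) f) μ ∧
          ∫ σ, liouvilleZ (pinnedChain ω₂ lam β γ) f σ ∂μ = 0 := by
  intro ω₂ lam β γ T hω hl hβ hT μ hμ hS f hf
  -- from "measurable with a finite first moment" to "integrable"
  have key : ∀ {h : ChainConfig → ℝ}, (Measurable h ∧ ∀ k : ℕ, Integrable (fun σ => |h σ| ^ k) μ) →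
      Integrable h μ := fun {h} hh => by
    have h1 := hh.2 1
    simp only [pow_one] at h1
    exact h1.mono' hh.1.aestronglyMeasurable
      (Eventually.of_forall fun σ => le_of_eq (Real.norm_eq_abs _))
  obtain ⟨⟨R, hR⟩, hAf⟩ := exists_rep_and_liouvilleZ_mem_of_mem_polyObs ω₂ lam β γ hf
  obtain ⟨g, hg, rfl⟩ := hR R le_rfl
  have hIf : Integrable (g ∘ boxRestrict R) μ :=
    key (measurable_and_integrable_pow_of_mem_polyObs γ hω hl hβ hT hμ hS hf)
  have hmkA := measurable_and_integrable_pow_of_mem_polyObs γ hω hl hβ hT hμ hS hAf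
  have hIA : Integrable (liouvilleZ (pinnedChain ω₂ lam β γ) (g ∘ boxRestrict R)) μ := key hmkA
  have hmA : Measurable (liouvilleZ (pinnedChain ω₂ lam β γ) (g ∘ boxRestrict R)) := hmkA.1
  refine ⟨hIA, ?_⟩
  rw [boxRestrict_eq_boxRestrictAt] at hIf hmA hIA ⊢
  exact integral_liouvilleZ_comp_boxRestrictAt_eq_zero_of_integrable
    (OscillatorChain.contDiff_two_U_pinnedChain ω₂ lam β γ)
    (OscillatorChain.contDiff_two_V_pinnedChain ω₂ lam β γ)
    (OscillatorChain.condB1_pinnedChain hω.le hl hβ γ) hμ _ _ hg hIf hmA hIA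

end Summit.AtomisticToContinuum.FouriersLaw.Theorems.DrudeDissolution.GramPencilHarmonicChaos

end
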